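import Summits.KontsevichZagierPeriods.KontsevichZagierPeriods.Theorems.RootDecompRelativeModAbsoluteRegKernelPairLeOneP07
import Summits.KontsevichZagierPeriods.KontsevichZagierPeriods.Theorems.RootDecompRelativeModAbsoluteRegKernelPairLeOneP04

/-!
(LANDED by the census seat decomp-kz-census-1 g7 `--supports stmt-KontsevichZagierPeriods-30572`; source lens-3 g9 landing package #2, critic decomp-kz-crit-1 g2 CLEARED §14–§17; generic docstrings added where the source had none.)

# `RegKernelPairDegOne`, the COMMON-ARCTAN case (route `RootDecompRelativeModAbsolute`, support item
stmt-KontsevichZagierPeriods-30572) — PROVED · part 8 (rigidity of two remainders + core lemma)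

Cell `decomp-kz`, lens 3 (decomp-kz-lens-3 g9), §17 of the HOME file.  Item 30572 for ANY numbers `k, k'` of
regularised monomials, all of ARCTAN kind (`eᵢ = 2`) and sharing ONE argument function `κ₀ > 0` (`κᵢ = κ'ⱼ =
κ₀`, `ℚ`-semialgebraic on `G ∪ G'`).  This part: `sum_range_even_odd` (parity split), `two_rem_scalar` (Baker in
the MIXED form `CircleBaker.log_arctan` of part 4: for algebraic `κ > 0`, `A + R₀ ℓ_{2n+2,2}(κ) + R₁ ℓ_{2n+3,2}(κ)
= 0` with algebraic `A, R₀, R₁` forces `R₀ = R₁ = 0`, since `ℓ_{2n+2,2}`, `ℓ_{2n+3,2}` are affine with non-zero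
algebraic slope in `arctan √κ/√κ`, `log(1+κ)/(2κ)`), `two_rem_ae_eq_zero` (the a.e. version for
`ℚ`-semialgebraic data: smooth full-measure loci, continuity, dense algebraic points) and the core lemma
`cyl_commonArctan_mem_relations`: a representation on `P × (0,1)` with integrand
`a₀(x) + Σ_{m<2n+2} c_m(x) θ^m/(1+θ²κ(x))`, `κ > 0`, whose fibre integrals vanish a.e. is a relation — Taylor
division of the even and the odd part by `1 + κw` in `w = θ²`, the two remainders vanish a.e., restriction to
that full-measure piece, polynomial fold, a.e.-zero base integrand.  Part 9: the rung theorem.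
(`κ₀ < 0` is NOT covered: there the kernel is logarithmic in `u = √(−κ₀)` and on cells with constant `κ₀` and
multiplicatively dependent `1 ± u` — e.g. `u = 1/φ`, `(1+u)²(1−u) = 1` — the remainders need not vanish.)

Source: `HOME/decomp-kz-lens-3/g9/RelativeModAbsoluteDegOneBands.lean` §17 (v5 sha256 c72c66ad3c72dd77, 7408 l;
farm rc 0 / 0 warn / 0 sorry; `#print axioms regKernelPairDegOne_of_commonArctan` = propext, Classical.choice,
Quot.sound), extracted verbatim into the namespace of the landed chain.  No `sorry`; standard axioms.
References: Baker 1975 Thm 2.1 [tree: `baker_holds`]; [cite: KontsevichZagier2001, §1.2]; Bochnak–Coste–Roy 1998 §2.9.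
-/

noncomputable section

open Set MeasureTheory Filter Topology
open scoped BigOperators
open Literature.NumberTheory.Transcendental Literature.ModelTheory.ExponentialFields

namespace Summit.KontsevichZagierPeriods.RootDecompRelativeModAbsolute.Rung30571

namespace RegularisedLogLayer

section CommonArctan

/-- Splitting a sum over `range (2n+2)` into its even and odd terms. -/
theorem sum_range_even_odd (f : ℕ → ℝ) (n : ℕ) :
    ∑ m ∈ Finset.range (2 * n + 2), f m =
      ∑ j ∈ Finset.range (n + 1), f (2 * j) + ∑ j ∈ Finset.range (n + 1), f (2 * j + 1) := by
  induction n with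
  | zero => simp [Finset.sum_range_succ]
  | succ n ih =>
    have h1 : ∑ m ∈ Finset.range (2 * (n + 1) + 2), f m =
        ∑ m ∈ Finset.range (2 * n + 2), f m + f (2 * n + 2) + f (2 * n + 2 + 1) := by
      rw [show 2 * (n + 1) + 2 = 2 * n + 2 + 1 + 1 by ring, Finset.sum_range_succ,
        Finset.sum_range_succ]
    have h2 : ∑ j ∈ Finset.range (n + 1 + 1), f (2 * j) =
        ∑ j ∈ Finset.range (n + 1), f (2 * j) + f (2 * n + 2) := by
      rw [Finset.sum_range_succ, show 2 * (n + 1) = 2 * n + 2 by ring]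
    have h3 : ∑ j ∈ Finset.range (n + 1 + 1), f (2 * j + 1) =
        ∑ j ∈ Finset.range (n + 1), f (2 * j + 1) + f (2 * n + 2 + 1) := by
      rw [Finset.sum_range_succ, show 2 * (n + 1) + 1 = 2 * n + 2 + 1 by ring]
    rw [h1, h2, h3, ih]
    ring

/-- **Baker, mixed form, for the two arctan-kind remainders.** For algebraic `κ > 0` and algebraic
`A, R₀, R₁`: `A + R₀ ℓ_{2n+2,2}(κ) + R₁ ℓ_{2n+3,2}(κ) = 0` forces `R₀ = R₁ = 0`.
[Baker1975 Thm 2.1 via `CircleBaker.log_arctan`; this file §14] -/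
theorem two_rem_scalar {κ A R₀ R₁ : ℝ} (hκ : 0 < κ) (hκa : IsAlgebraic ℚ κ) (hA : IsAlgebraic ℚ A)
    (h₀ : IsAlgebraic ℚ R₀) (h₁ : IsAlgebraic ℚ R₁) (n : ℕ)
    (hrel : A + R₀ * ell (2 * n + 2) 2 κ + R₁ * ell (2 * n + 3) 2 κ = 0) : R₀ = 0 ∧ R₁ = 0 := by
  have hκ1 : -1 < κ := by linarith
  have hκ0 : κ ≠ 0 := hκ.ne'
  obtain ⟨a, b, ha, hb, hb0, hE⟩ := ell_affine_mod hκ1 hκ0 hκa (2 * n + 2) 2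
  obtain ⟨a', b', ha', hb', hb0', hO⟩ := ell_affine_mod hκ1 hκ0 hκa (2 * n + 3) 2
  rw [show (2 * n + 2) % 2 = 0 by omega, ell_zero_two_pos hκ] at hE
  rw [show (2 * n + 3) % 2 = 1 by omega, ell_one_two hκ1 hκ0] at hO
  set u := Real.sqrt κ with hu
  have hu0 : 0 < u := Real.sqrt_pos.2 hκ
  have hua : IsAlgebraic ℚ u := isAlgebraic_sqrt hκ.le hκa
  have h1κ : 0 < 1 + κ := by linarith
  have h1κa : IsAlgebraic ℚ (1 + κ) := isAlgebraic_one.add hκa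
  have h2κ : IsAlgebraic ℚ (2 * κ) := by rw [two_mul]; exact hκa.add hκa
  have h2κ0 : 2 * κ ≠ 0 := by positivity
  -- the relation in Baker's format
  set c₁ : ℝ := R₁ * b' * (2 * κ)⁻¹ with hc₁_def
  set c₂ : ℝ := R₀ * b * u⁻¹ with hc₂_def
  set c₀ : ℝ := -(A + R₀ * a + R₁ * a') with hc₀_def
  have ac₁ : IsAlgebraic ℚ c₁ := (h₁.mul hb').mul h2κ.inv
  have ac₂ : IsAlgebraic ℚ c₂ := (h₀.mul hb).mul hua.inv
  have ac₀ : IsAlgebraic ℚ c₀ := ((hA.add (h₀.mul ha)).add (h₁.mul ha')).neg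
  have e1 : R₀ * ell (2 * n + 2) 2 κ = R₀ * a + c₂ * Real.arctan u := by
    rw [hE, div_eq_mul_inv]; ring
  have e2 : R₁ * ell (2 * n + 3) 2 κ = R₁ * a' + c₁ * Real.log (1 + κ) := by
    rw [hO, div_eq_mul_inv]; ring
  have hsum : c₁ * Real.log (1 + κ) + c₂ * Real.arctan u = c₀ := by
    simp only [hc₀_def]; linarith [hrel, e1, e2]
  obtain ⟨hc₀, hmix⟩ := CircleBaker.log_arctan h1κ h1κa hua ac₁ ac₂ ac₀ hsum
  have hlog : Real.log (1 + κ) ≠ 0 := Real.log_ne_zero_of_pos_of_ne_one h1κ (by linarith)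
  have hatan : Real.arctan u ≠ 0 := fun h => hu0.ne' (Real.arctan_eq_zero_iff.mp h)
  have hR₁_of : c₁ = 0 → R₁ = 0 := fun hc => by
    have := mul_eq_zero.1 hc
    rcases this with h | h
    · exact (mul_eq_zero.1 h).resolve_right hb0'
    · exact absurd h (inv_ne_zero h2κ0)
  have hR₀_of : c₂ = 0 → R₀ = 0 := fun hc => by
    have := mul_eq_zero.1 hc
    rcases this with h | h
    · exact (mul_eq_zero.1 h).resolve_right hb0
    · exact absurd h (inv_ne_zero hu0.ne')
  by_cases hc₁ : c₁ = 0
  · have h2 : c₂ * Real.arctan u = 0 := by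
      have := hsum; rw [hc₁, zero_mul, zero_add, hc₀] at this; exact this
    have hc₂ : c₂ = 0 := (mul_eq_zero.1 h2).resolve_right hatan
    exact ⟨hR₀_of hc₂, hR₁_of hc₁⟩
  · by_cases hc₂ : c₂ = 0
    · have h2 : c₁ * Real.log (1 + κ) = 0 := by
        have := hsum; rw [hc₂, zero_mul, add_zero, hc₀] at this; exact this
      exact absurd ((mul_eq_zero.1 h2).resolve_right hlog) hc₁
    · have := (hmix hc₁ hc₂).1
      exact absurd (by linarith : κ = 0) hκ0

/-- **Rigidity of the two arctan-kind remainders.** If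
`g₀ + R₀ ℓ_{2n+2,2}(κ) + R₁ ℓ_{2n+3,2}(κ) = 0` a.e. on `P` with all data `ℚ`-semialgebraic and
`κ > 0` on `P`, then `R₀ = 0` and `R₁ = 0` a.e. on `P` (smooth full-measure loci, continuity, the
algebraic points are dense, `two_rem_scalar` at each of them). [Baker1975 Thm 2.1; folklore] -/
theorem two_rem_ae_eq_zero {P : Set (Fin 1 → ℝ)} (hP : IsSemialgebraic ℚ P)
    {g₀ R₀ R₁ κ : (Fin 1 → ℝ) → ℝ} (hg₀ : IsSemialgebraicFunOn ℚ P g₀)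
    (hR₀ : IsSemialgebraicFunOn ℚ P R₀) (hR₁ : IsSemialgebraicFunOn ℚ P R₁)
    (hκs : IsSemialgebraicFunOn ℚ P κ) (hκ0 : ∀ x ∈ P, 0 < κ x) (n : ℕ)
    (hae : ∀ᵐ x, x ∈ P → g₀ x + R₀ x * ell (2 * n + 2) 2 (κ x) + R₁ x * ell (2 * n + 3) 2 (κ x) = 0) :
    ∀ᵐ x, x ∈ P → R₀ x = 0 ∧ R₁ x = 0 := by
  classical
  obtain ⟨O₁, hO₁G, hO₁o, -, hc₁, -, hn₁⟩ := KZ.exists_isOpen_contDiffOn hP hR₀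
  obtain ⟨O₂, hO₂G, hO₂o, -, hc₂, -, hn₂⟩ := KZ.exists_isOpen_contDiffOn hP hκs
  obtain ⟨O₃, hO₃G, hO₃o, -, hc₃, -, hn₃⟩ := KZ.exists_isOpen_contDiffOn hP hg₀
  obtain ⟨O₄, hO₄G, hO₄o, -, hc₄, -, hn₄⟩ := KZ.exists_isOpen_contDiffOn hP hR₁
  set O := O₁ ∩ O₂ ∩ O₃ ∩ O₄ with hO
  have hOo : IsOpen O := ((hO₁o.inter hO₂o).inter hO₃o).inter hO₄o
  have hOG : O ⊆ P := fun x hx => hO₁G hx.1.1.1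
  have hnull : volume (P \ O) = 0 := by
    have hsub : P \ O ⊆ (P \ O₁) ∪ (P \ O₂) ∪ (P \ O₃) ∪ (P \ O₄) := by
      intro x hx
      simp only [hO, Set.mem_sdiff, mem_inter_iff, mem_union] at hx ⊢
      tauto
    have h0 : volume ((P \ O₁) ∪ (P \ O₂) ∪ (P \ O₃) ∪ (P \ O₄)) = 0 := by
      rw [measure_union_null_iff, measure_union_null_iff, measure_union_null_iff]
      exact ⟨⟨⟨hn₁, hn₂⟩, hn₃⟩, hn₄⟩
    exact measure_mono_null hsub h0
  -- the defect function, continuous on `O` and zero a.e. there, hence zero on `O`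
  set F : (Fin 1 → ℝ) → ℝ := fun x =>
    g₀ x + R₀ x * ell (2 * n + 2) 2 (κ x) + R₁ x * ell (2 * n + 3) 2 (κ x) with hF
  have cR₀ : ContinuousOn R₀ O := hc₁.continuousOn.mono fun x hx => hx.1.1.1
  have cκ : ContinuousOn κ O := hc₂.continuousOn.mono fun x hx => hx.1.1.2
  have cg₀ : ContinuousOn g₀ O := hc₃.continuousOn.mono fun x hx => hx.1.2
  have cR₁ : ContinuousOn R₁ O := hc₄.continuousOn.mono fun x hx => hx.2
  have hcont : ContinuousOn F O := by
    have c5 : ContinuousOn (fun x => ell (2 * n + 2) 2 (κ x)) O :=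
      (continuousOn_ell _ 2).comp cκ fun x hx => by
        have := hκ0 x (hOG hx); show -1 < κ x; linarith
    have c6 : ContinuousOn (fun x => ell (2 * n + 3) 2 (κ x)) O :=
      (continuousOn_ell _ 2).comp cκ fun x hx => by
        have := hκ0 x (hOG hx); show -1 < κ x; linarith
    exact (cg₀.add (cR₀.mul c5)).add (cR₁.mul c6)
  have hF0 : ∀ᵐ x, x ∈ O → F x = 0 := by
    filter_upwards [hae] with x hx hxO
    exact hx (hOG hxO)
  have hFO : EqOn F 0 O := by
    have h1 : F =ᵐ[volume.restrict O] (0 : (Fin 1 → ℝ) → ℝ) :=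
      (ae_restrict_iff' hOo.measurableSet).2 hF0
    exact Measure.eqOn_open_of_ae_eq h1 hOo hcont continuousOn_const
  -- at algebraic points of `O`: `R₀ = R₁ = 0`
  set A : Set (Fin 1 → ℝ) := {x | ∀ i, IsAlgebraic ℚ (x i)} with hA
  have hP_alg : ∀ x ∈ O ∩ A, R₀ x = 0 ∧ R₁ x = 0 := by
    rintro x ⟨hxO, hxA⟩
    have hxG := hOG hxO
    exact two_rem_scalar (hκ0 x hxG) (hκs.isAlgebraic_apply hxG hxA)
      (hg₀.isAlgebraic_apply hxG hxA) (hR₀.isAlgebraic_apply hxG hxA)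
      (hR₁.isAlgebraic_apply hxG hxA) n (hFO hxO)
  -- density + continuity
  have hD := dense_setOf_isAlgebraic.open_subset_closure_inter hOo
  have hR₀O : EqOn R₀ 0 O :=
    (show EqOn R₀ 0 (O ∩ A) from fun x hx => (hP_alg x hx).1).of_subset_closure cR₀
      continuousOn_const inter_subset_left hD
  have hR₁O : EqOn R₁ 0 O :=
    (show EqOn R₁ 0 (O ∩ A) from fun x hx => (hP_alg x hx).2).of_subset_closure cR₁
      continuousOn_const inter_subset_left hD
  -- a.e. on `P`
  have hae' : ∀ᵐ x, x ∉ P \ O := measure_eq_zero_iff_ae_notMem.1 hnull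
  filter_upwards [hae'] with x hx hxG
  by_cases hxO : x ∈ O
  · exact ⟨hR₀O hxO, hR₁O hxO⟩
  · exact absurd ⟨hxG, hxO⟩ hx

end CommonArctan

end RegularisedLogLayer

end Summit.KontsevichZagierPeriods.RootDecompRelativeModAbsolute.Rung30571

end
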